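import Literature.Topology.FourManifolds.SPC4MorseExistence
import Literature.Geometry.Manifold.SmoothExhaustionFunction
import HarnessLib

/-!
# Proper Morse functions on open manifolds (Phillips 1967, Lemma 1.1, first clause)

Topic `Literature/Topology/FourManifolds` (Morse theory infrastructure; consumer: the named fact
`Literature.Topology.Immersions.Phillips1967_exists_isLocalDiffeomorph_of_isParallelizable`,
whose printed proof begins with Phillips' Lemma 1.1: *"An open `n`-dimensional manifold `M` has
a non-negative, proper Morse function with no critical points of index `n`"*). Everything here
is **proved**; no definitions and no named facts are introduced.

* `Literature.Topology.FourManifolds.exists_isMorse_tendsto_cocompact_atTop` — **every manifold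
  without boundary carries a non-negative proper Morse function**: for a `C^∞` manifold `M`
  (Hausdorff, σ-compact, finite-dimensional model, `BoundarylessManifold`) there is a Morse
  function `g : M → ℝ` (`Literature.Topology.FourManifolds.IsMorse`), `0 ≤ g`, tending to `+∞`
  along the cocompact filter (all sublevel sets compact). This is the first clause of Phillips'
  Lemma 1.1 (the clause "no critical points of index `n`", Milnor's cancellation theorem, is not
  treated here); Hirsch, *Differential Topology* (1976), Ch. 6, Thm. 1.2 ("For any manifold `M`,
  Morse functions form a dense open set in `C_S^s(M, ℝ)`, `2 ≤ s ≤ ∞`") applied to a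
  neighbourhood of a proper function; Milnor, *Morse theory* (1963), Cor. 6.7.

Proof (Milnor, *Lectures on the h-cobordism theorem* (1965), proof of Thm. 2.7, run over a
countable locally finite family of chart balls instead of a finite one). Start from a smooth
exhaustion function `f₀ ≥ 1`
(`Literature.Geometry.Manifold.exists_contMDiff_tendsto_cocompact_atTop`). Cover `M` by
countably many interior chart balls `κᵢ` (the tree's
`Literature.Topology.FourManifolds.ChartBall`: bump `ρᵢ`, compact piece `Kᵢ`, open piece `Uᵢ`)
whose bump supports form a locally finite family (`exists_countable_locallyFinite_chartBall`:
finitely many balls for each shell `K (j+1) ∖ interior (K j)` of a compact exhaustion, with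
supports in the open shells `interior (K (j+2)) ∖ K (j-1)`). Enumerate the balls injectively by
natural numbers and perturb successively, `f_{k+1} = f_k + ρ (ℓ_k ∘ φ)` in the ball numbered `k`
(if any), with `ℓ_k` generic (Milnor's Lemma A, `exists_clm_norm_lt_forall_injective`) and so
small that (Lemma B, `ChartBall.exists_forall_good_list`) the absence of degenerate critical
points on the compact pieces of the balls already treated is preserved and `|f_{k+1} - f_k| ≤
2^{-(k+1)}` (`ChartBall.exists_good_norm_le`, `ChartBall.abs_pert_le_of_r`). By local
finiteness the sequence `f_k` is eventually constant near every point, so its limit `g` is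
smooth, has no degenerate critical point on any compact piece — i.e. (the Hessian read in a
chart, `nondegenerate_mhessian_iff_of_isMCriticalPt`) is a Morse function — and
`|g - f₀| ≤ 1`, whence `g ≥ 0` is proper.

## References

* A. Phillips, *Submersions of open manifolds*, Topology 6 (1967), Lemma 1.1 (p. 176).
  [Phillips1967]
* M. W. Hirsch, *Differential Topology*, GTM 33 (1976), Ch. 6 §1, Thm. 1.2. [HirschDT1976]
* J. Milnor, *Lectures on the h-cobordism theorem* (1965), §2, Lemmas A, B and proof of
  Thm. 2.7 (pp. 8–10). [MilnorHCobordism1965]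
* J. Milnor, *Morse theory*, Ann. of Math. Studies 51 (1963), §6, Cor. 6.7. [Milnor1963]
-/

universe u

open scoped Manifold ContDiff Topology
open Set Function Filter Metric

noncomputable section

namespace Literature.Topology.FourManifolds

variable {E : Type*} [NormedAddCommGroup E] [NormedSpace ℝ E] [FiniteDimensional ℝ E]
  {H : Type*} [TopologicalSpace H] {I : ModelWithCorners ℝ E H}
  {M : Type u} [TopologicalSpace M] [ChartedSpace H M] [T2Space M] [IsManifold I ∞ M]

namespace ChartBall

/-! ### One perturbation step with a prescribed bound on the linear form -/

/-- **One step of Milnor's iteration, with a norm bound.** Given a smooth `f` without degenerate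
critical points on the compact pieces of the balls of `done` and `δ > 0`, there is a linear
form `ℓ`, `‖ℓ‖ ≤ δ`, such that `f + ρ (ℓ ∘ φ)` (perturbation in the ball `κ`) still has no
degenerate critical point on those compact pieces (Lemma B) and has none on the compact piece
of `κ` (Lemma A in the chart of `κ`). [cite: MilnorHCobordism1965, §2 proof of Thm. 2.7] -/
theorem exists_good_norm_le [MeasurableSpace E] [BorelSpace E] (κ : ChartBall I M) {f : M → ℝ}
    (hf : ContMDiff I 𝓘(ℝ, ℝ) ∞ f) (done : List (ChartBall I M))
    (hgood : ∀ κ' ∈ done, κ'.Good f) {δ : ℝ} (hδ : 0 < δ) :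
    ∃ ℓ : E →L[ℝ] ℝ, ‖ℓ‖ ≤ δ ∧ (∀ κ' ∈ done, κ'.Good (f + κ.pert ℓ)) ∧
      κ.Good (f + κ.pert ℓ) := by
  obtain ⟨δ₁, hδ₁, h₁⟩ := exists_forall_good_list (κ := κ) done hf hgood
  obtain ⟨ℓ, hℓ, hA⟩ := exists_clm_norm_lt_forall_injective κ.isOpen_target κ.K_subset_target
    (κ.contDiffOn_fhat hf) (lt_min hδ₁ hδ)
  refine ⟨ℓ, hℓ.le.trans (min_le_right _ _), h₁ ℓ (hℓ.le.trans (min_le_left _ _)),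
    fun z hz h0 => ?_⟩
  have hev : κ.fhat (f + κ.pert ℓ) =ᶠ[𝓝 z] fun w => κ.fhat f w + ℓ w := by
    filter_upwards [κ.pert_comp_symm_eventuallyEq ℓ hz] with w hw
    simp only [fhat_add, Pi.add_apply]
    rw [show κ.fhat (κ.pert ℓ) w = (κ.pert ℓ ∘ (extChartAt I κ.c).symm) w from rfl, hw]
  have hpair : pairD (κ.fhat (f + κ.pert ℓ)) z =
      (fderiv ℝ (κ.fhat f) z + ℓ, fderiv ℝ (fderiv ℝ (κ.fhat f)) z) := by
    rw [pairD_congr_of_eventuallyEq hev]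
    exact pairD_add_clm κ.isOpen_target (κ.contDiffOn_fhat hf) ℓ (κ.K_subset_target hz)
  rw [hpair] at h0 ⊢
  exact hA z hz h0

omit [IsManifold I ∞ M] in
/-- **Uniform bound for the bump perturbation**: `|ρ (ℓ ∘ φ)| ≤ ‖ℓ‖ (‖φ c‖ + r)` everywhere
(on the support the chart image is within `r` of `φ c`, elsewhere the perturbation vanishes).
[folklore] -/
theorem abs_pert_le_of_r (κ : ChartBall I M) (ℓ : E →L[ℝ] ℝ) (y : M) :
    |κ.pert ℓ y| ≤ ‖ℓ‖ * (‖extChartAt I κ.c κ.c‖ + κ.r) := by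
  by_cases hy : y ∈ tsupport κ.ρ
  · have hd : dist (extChartAt I κ.c y) (extChartAt I κ.c κ.c) ≤ κ.r :=
      (κ.tsupport_ρ_subset hy).2
    have hn : ‖extChartAt I κ.c y‖ ≤ ‖extChartAt I κ.c κ.c‖ + κ.r := by
      calc ‖extChartAt I κ.c y‖
          ≤ ‖extChartAt I κ.c κ.c‖ + ‖extChartAt I κ.c y - extChartAt I κ.c κ.c‖ :=
            norm_le_insert' _ _
        _ ≤ ‖extChartAt I κ.c κ.c‖ + κ.r := by rw [← dist_eq_norm]; gcongr
    exact (κ.abs_pert_le ℓ y).trans (mul_le_mul_of_nonneg_left hn (norm_nonneg ℓ))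
  · rw [κ.pert_eq_zero_of_notMem_tsupport hy, abs_zero]
    exact mul_nonneg (norm_nonneg ℓ) (by linarith [κ.r_pos, norm_nonneg (extChartAt I κ.c κ.c)])

end ChartBall

/-! ### Chart balls inside prescribed open sets; a countable locally finite cover -/

omit [IsManifold I ∞ M] in
/-- **Small chart balls**: about an interior point `x` and inside any neighbourhood `W` of `x`
there is an interior chart ball centred at `x` whose bump is supported in `W` (take the radius
below the distance to the complement of the chart target and of `φ⁻¹(W)`). [folklore] -/
theorem exists_chartBall_tsupport_subset_of_mem_nhds {x : M} (hx : I.IsInteriorPoint x)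
    {W : Set M} (hW : W ∈ 𝓝 x) : ∃ κ : ChartBall I M, κ.c = x ∧ tsupport κ.ρ ⊆ W := by
  have hmem : extChartAt I x x ∈ (interiorExtChart I x).target :=
    (interiorExtChart I x).map_source (mem_interiorExtChart_source_self hx)
  obtain ⟨r₁, hr₁, hsub₁⟩ := Metric.nhds_basis_closedBall.mem_iff.1
    ((interiorExtChart I x).open_target.mem_nhds hmem)
  have hW' : (extChartAt I x).symm ⁻¹' W ∈ 𝓝 (extChartAt I x x) := by
    refine (continuousAt_extChartAt_symm x).preimage_mem_nhds ?_
    rwa [extChartAt_to_inv]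
  obtain ⟨r₂, hr₂, hsub₂⟩ := Metric.nhds_basis_closedBall.mem_iff.1 hW'
  refine ⟨⟨x, min r₁ r₂, lt_min hr₁ hr₂,
    (closedBall_subset_closedBall (min_le_left _ _)).trans hsub₁⟩, rfl, fun y hy => ?_⟩
  obtain ⟨hys, hyd⟩ := ChartBall.tsupport_ρ_subset _ hy
  have h2 : extChartAt I x y ∈ closedBall (extChartAt I x x) r₂ :=
    mem_closedBall.2 (hyd.trans (min_le_right _ _))
  have h3 := hsub₂ h2
  rw [mem_preimage, (extChartAt I x).left_inv (by rwa [extChartAt_source])] at h3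
  exact h3

omit [IsManifold I ∞ M] in
/-- **A countable, locally finite family of chart balls covering `M`** (σ-compact, locally
compact, all points interior): there is a countable set `S` of interior chart balls whose open
pieces `U` cover `M` and whose bump supports form a locally finite family. Construction: for a
compact exhaustion `K`, cover each compact shell `K j ∖ interior (K (j-1))` by finitely many
balls with supports in the open shell `interior (K (j+1)) ∖ K (j-2)`; these open shells form a
locally finite family. [folklore] -/
theorem exists_countable_locallyFinite_chartBall [SigmaCompactSpace M] [LocallyCompactSpace M]
    (hint : ∀ x : M, I.IsInteriorPoint x) :
    ∃ S : Set (ChartBall I M), S.Countable ∧ (∀ x : M, ∃ κ ∈ S, x ∈ κ.U) ∧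
      LocallyFinite (fun κ : S => tsupport κ.1.ρ) := by
  classical
  set K : CompactExhaustion M := CompactExhaustion.choice M with hK
  -- shells and open shells
  set Apred : ℕ → Set M := fun j => if 1 ≤ j then interior (K (j - 1)) else ∅ with hApred
  set Kpred : ℕ → Set M := fun j => if 2 ≤ j then K (j - 2) else ∅ with hKpred
  set A : ℕ → Set M := fun j => K j \ Apred j with hA
  set O : ℕ → Set M := fun j => interior (K (j + 1)) \ Kpred j with hO
  have hApred_open : ∀ j, IsOpen (Apred j) := fun j => by
    simp only [hApred]; split_ifs
    · exact isOpen_interior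
    · exact isOpen_empty
  have hKpred_closed : ∀ j, IsClosed (Kpred j) := fun j => by
    simp only [hKpred]; split_ifs
    · exact K.isClosed _
    · exact isClosed_empty
  have hAc : ∀ j, IsCompact (A j) := fun j => (K.isCompact j).diff (hApred_open j)
  have hOo : ∀ j, IsOpen (O j) := fun j => isOpen_interior.sdiff (hKpred_closed j)
  have hAO : ∀ j, A j ⊆ O j := by
    intro j x hx
    refine ⟨K.subset_interior_succ j hx.1, fun hx' => hx.2 ?_⟩
    simp only [hKpred] at hx'
    split_ifs at hx' with h2
    · simp only [hApred, if_pos (show 1 ≤ j by omega)]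
      have : K (j - 2) ⊆ interior (K (j - 2 + 1)) := K.subset_interior_succ (j - 2)
      rw [show j - 2 + 1 = j - 1 by omega] at this
      exact this hx'
    · exact hx'.elim
  have hAcov : ∀ x : M, ∃ j, x ∈ A j := by
    intro x
    refine ⟨Nat.find (K.exists_mem x), Nat.find_spec (K.exists_mem x), fun hx => ?_⟩
    simp only [hApred] at hx
    split_ifs at hx with h1
    · exact Nat.find_min (K.exists_mem x) (show Nat.find (K.exists_mem x) - 1 <
        Nat.find (K.exists_mem x) by omega) (interior_subset hx)
    · exact hx.elim
  have hOlf : ∀ x : M, ∃ V ∈ 𝓝 x, {j | (O j ∩ V).Nonempty}.Finite := by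
    intro x
    obtain ⟨n, hn⟩ := K.exists_mem x
    refine ⟨interior (K (n + 1)), isOpen_interior.mem_nhds (K.subset_interior_succ n hn),
      (finite_lt_nat (n + 3)).subset fun j hj => ?_⟩
    by_contra hlt
    simp only [mem_setOf_eq, not_lt] at hlt
    obtain ⟨y, hyO, hyV⟩ := hj
    have hy1 : y ∈ K (j - 2) := K.subset (show n + 1 ≤ j - 2 by omega) (interior_subset hyV)
    exact hyO.2 (by simp only [hKpred, if_pos (show 2 ≤ j by omega)]; exact hy1)
  -- balls centred at the points of the shells, supported in the open shells
  have hball : ∀ (j : ℕ) (x : A j), ∃ κ : ChartBall I M, κ.c = x.1 ∧ tsupport κ.ρ ⊆ O j :=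
    fun j x => exists_chartBall_tsupport_subset_of_mem_nhds (hint x.1)
      ((hOo j).mem_nhds (hAO j x.2))
  choose κ hκc hκO using hball
  -- finitely many balls per shell
  have hcov : ∀ j, A j ⊆ ⋃ x : A j, (κ j x).U := fun j y hy =>
    mem_iUnion.2 ⟨⟨y, hy⟩, by
      have h := (κ j ⟨y, hy⟩).c_mem_U
      rwa [hκc j ⟨y, hy⟩] at h⟩
  have hfin : ∀ j, ∃ t : Finset (A j), A j ⊆ ⋃ x ∈ t, (κ j x).U := fun j =>
    (hAc j).elim_finite_subcover (fun x : A j => (κ j x).U) (fun x => (κ j x).isOpen_U) (hcov j)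
  choose t ht using hfin
  -- the family
  set S : Set (ChartBall I M) := ⋃ j, (κ j) '' (t j : Set (A j)) with hS
  refine ⟨S, ?_, fun x => ?_, ?_⟩
  · exact countable_iUnion fun j => ((t j).finite_toSet.image _).countable
  · obtain ⟨j, hj⟩ := hAcov x
    have := ht j hj
    simp only [mem_iUnion, exists_prop] at this
    obtain ⟨x', hx't, hx'U⟩ := this
    exact ⟨κ j x', mem_iUnion.2 ⟨j, mem_image_of_mem _ hx't⟩, hx'U⟩
  · intro x
    obtain ⟨V, hV, hVfin⟩ := hOlf x
    refine ⟨V, hV, ?_⟩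
    -- the balls whose support meets `V` come from the finitely many shells meeting `V`
    have hsub : {b : ChartBall I M | b ∈ S ∧ (tsupport b.ρ ∩ V).Nonempty} ⊆
        ⋃ j ∈ {j | (O j ∩ V).Nonempty}, (κ j) '' (t j : Set (A j)) := by
      rintro b ⟨hbS, hbV⟩
      simp only [hS, mem_iUnion] at hbS
      obtain ⟨j, x', hx't, rfl⟩ := hbS
      refine mem_iUnion₂.2 ⟨j, ?_, mem_image_of_mem _ hx't⟩
      obtain ⟨y, hy1, hy2⟩ := hbV
      exact ⟨y, hκO j x' hy1, hy2⟩
    have hfinS : {b : ChartBall I M | b ∈ S ∧ (tsupport b.ρ ∩ V).Nonempty}.Finite :=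
      (hVfin.biUnion fun j _ => (t j).finite_toSet.image _).subset hsub
    refine (hfinS.preimage (Subtype.val_injective.injOn)).subset fun b hb => ?_
    exact ⟨b.2, hb⟩

/-! ### Non-negative proper Morse functions -/

/-- **Every manifold without boundary carries a non-negative proper Morse function** (Phillips
1967, Lemma 1.1, first clause: "An open `n`-dimensional manifold `M` has a non-negative, proper
Morse function …"; Hirsch, *Differential Topology* (1976), Ch. 6 Thm. 1.2 — Morse functions are
dense in the strong topology — applied about a proper function; Milnor, *Morse theory* (1963),
Cor. 6.7). For a `C^∞` manifold `M` without boundary (Hausdorff, σ-compact, locally compact,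
finite-dimensional model) there is a Morse function `g ≥ 0` on `M` tending to `+∞` along the
cocompact filter. Proof: Milnor's iteration (h-cobordism notes, proof of Thm. 2.7) over a
countable locally finite family of chart balls, started at a smooth exhaustion function; see the
module docstring. [cite: Phillips1967, Lemma 1.1 (p. 176)] [cite: HirschDT1976, Ch. 6 Thm. 1.2]
[cite: MilnorHCobordism1965, §2 proof of Thm. 2.7] -/
theorem exists_isMorse_tendsto_cocompact_atTop [MeasurableSpace E] [BorelSpace E]
    [SigmaCompactSpace M] [LocallyCompactSpace M] [BoundarylessManifold I M] :
    ∃ g : M → ℝ, IsMorse I g ∧ (∀ x, 0 ≤ g x) ∧ Tendsto g (cocompact M) atTop := by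
  classical
  -- a smooth exhaustion function `f₀ ≥ 1`
  obtain ⟨f₀, hf₀, hf₀1, hf₀t⟩ :=
    Literature.Geometry.Manifold.exists_contMDiff_tendsto_cocompact_atTop (I := I) (M := M)
  -- a countable locally finite family of chart balls, enumerated injectively
  have hint : ∀ x : M, I.IsInteriorPoint x := fun x => BoundarylessManifold.isInteriorPoint' x
  obtain ⟨S, hSc, hSU, hSlf⟩ := exists_countable_locallyFinite_chartBall (I := I) (M := M) hint
  obtain ⟨code, hcode⟩ := Set.countable_iff_exists_injective.1 hSc
  -- size of the chart image of each ball (for the uniform bound on perturbations)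
  let B : S → ℝ := fun b => ‖extChartAt I b.1.c b.1.c‖ + b.1.r
  have hB0 : ∀ b : S, 0 ≤ B b := fun b => by
    have h1 := b.1.r_pos
    have h2 := norm_nonneg (extChartAt I b.1.c b.1.c)
    simp only [B]
    linarith
  have hB : ∀ b : S, 0 < B b + 1 := fun b => by linarith [hB0 b]
  -- the invariant after `k` steps, and the relation between consecutive steps
  let P : ℕ → (M → ℝ) → Prop := fun k f =>
    ContMDiff I 𝓘(ℝ, ℝ) ∞ f ∧ ∀ b : S, code b < k → b.1.Good f
  let Q : ℕ → (M → ℝ) → (M → ℝ) → Prop := fun k f f' =>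
    (∀ y, |f' y - f y| ≤ (2 : ℝ)⁻¹ ^ (k + 1)) ∧
      ∀ y, (∀ b : S, code b = k → y ∉ tsupport b.1.ρ) → f' y = f y
  have hstep : ∀ (k : ℕ) (s : {f : M → ℝ // P k f}),
      ∃ s' : {f : M → ℝ // P (k + 1) f}, Q k s.1 s'.1 := by
    rintro k ⟨f, hf, hgood⟩
    by_cases hk : ∃ b : S, code b = k
    · obtain ⟨b, hb⟩ := hk
      -- the balls already treated
      have hfin : {b' : S | code b' < k}.Finite := (finite_lt_nat k).preimage hcode.injOn
      set done : List (ChartBall I M) := hfin.toFinset.toList.map (fun b' : S => b'.1)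
        with hdone
      have hmem_done : ∀ κ' : ChartBall I M, κ' ∈ done ↔ ∃ b' : S, code b' < k ∧ b'.1 = κ' := by
        intro κ'
        simp only [hdone, List.mem_map, Finset.mem_toList, Finite.mem_toFinset, mem_setOf_eq]
      have hdone_good : ∀ κ' ∈ done, κ'.Good f := by
        intro κ' hκ'
        obtain ⟨b', hb', rfl⟩ := (hmem_done κ').1 hκ'
        exact hgood b' hb'
      have hδ : 0 < (2 : ℝ)⁻¹ ^ (k + 1) / (B b + 1) := div_pos (pow_pos (by norm_num) _) (hB b)
      obtain ⟨ℓ, hℓ, hgood', hgoodb⟩ := b.1.exists_good_norm_le hf done hdone_good hδ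
      refine ⟨⟨f + b.1.pert ℓ, hf.add (b.1.contMDiff_pert ℓ), fun b' hb' => ?_⟩,
        fun y => ?_, fun y hy => ?_⟩
      · rcases Nat.lt_or_ge (code b') k with h | h
        · exact hgood' _ ((hmem_done _).2 ⟨b', h, rfl⟩)
        · obtain rfl : b' = b := hcode (by omega)
          exact hgoodb
      · simp only [Pi.add_apply, add_sub_cancel_left]
        calc |b.1.pert ℓ y| ≤ ‖ℓ‖ * B b := b.1.abs_pert_le_of_r ℓ y
          _ ≤ (2 : ℝ)⁻¹ ^ (k + 1) / (B b + 1) * (B b + 1) :=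
              mul_le_mul hℓ (by linarith) (hB0 b) hδ.le
          _ = (2 : ℝ)⁻¹ ^ (k + 1) := div_mul_cancel₀ _ (hB b).ne'
      · simp only [Pi.add_apply]
        rw [b.1.pert_eq_zero_of_notMem_tsupport (hy b hb), add_zero]
    · refine ⟨⟨f, hf, fun b' hb' => hgood b' ?_⟩, fun y => by simp, fun y _ => rfl⟩
      rcases Nat.lt_or_ge (code b') k with h | h
      · exact h
      · exact absurd ⟨b', by omega⟩ hk
  choose step hstepQ using hstep
  -- the sequence of successive perturbations
  let s₀ : {f : M → ℝ // P 0 f} := ⟨f₀, hf₀, fun b hb => absurd hb (Nat.not_lt_zero _)⟩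
  let seq : (k : ℕ) → {f : M → ℝ // P k f} := fun k =>
    Nat.rec (motive := fun k => {f : M → ℝ // P k f}) s₀ (fun k s => step k s) k
  have hQ : ∀ k, Q k (seq k).1 (seq (k + 1)).1 := fun k => hstepQ k (seq k)
  -- local stabilisation (local finiteness of the supports)
  have hstab : ∀ x : M, ∃ V ∈ 𝓝 x, ∃ N : ℕ, ∀ k, N ≤ k →
      ∀ y ∈ V, (seq (k + 1)).1 y = (seq k).1 y := by
    intro x
    obtain ⟨V, hV, hfin⟩ := hSlf x
    refine ⟨V, hV, hfin.toFinset.sup (fun b => code b) + 1, fun k hk y hy => ?_⟩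
    refine (hQ k).2 y fun b hb hyb => ?_
    have hbfin : b ∈ hfin.toFinset := by
      rw [Finite.mem_toFinset]
      exact ⟨y, hyb, hy⟩
    have : code b ≤ hfin.toFinset.sup (fun b => code b) := Finset.le_sup hbfin
    omega
  have hstab' : ∀ x : M, ∃ V ∈ 𝓝 x, ∃ N : ℕ, ∀ k, N ≤ k →
      ∀ y ∈ V, (seq k).1 y = (seq N).1 y := by
    intro x
    obtain ⟨V, hV, N, hN⟩ := hstab x
    refine ⟨V, hV, N, fun k hk y hy => ?_⟩
    induction k, hk using Nat.le_induction with
    | base => rfl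
    | succ k hk ih => rw [hN k hk y hy, ih]
  -- the limit function
  have hconst : ∀ x : M, ∃ N : ℕ, ∀ k, N ≤ k → (seq k).1 x = (seq N).1 x := by
    intro x
    obtain ⟨V, hV, N, hN⟩ := hstab' x
    exact ⟨N, fun k hk => hN k hk x (mem_of_mem_nhds hV)⟩
  choose N hN using hconst
  set g : M → ℝ := fun x => (seq (N x)).1 x with hg
  -- `g` agrees with `seq N'` near every point, for all large `N'`
  have hloc : ∀ x : M, ∃ N₀ : ℕ, ∀ N', N₀ ≤ N' → g =ᶠ[𝓝 x] (seq N').1 := by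
    intro x
    obtain ⟨V, hV, N₀, hN₀⟩ := hstab' x
    refine ⟨N₀, fun N' hN' => ?_⟩
    filter_upwards [hV] with y hy
    have h1 : (seq (max (N y) N')).1 y = (seq (N y)).1 y := hN y _ (le_max_left _ _)
    have h2 : (seq (max (N y) N')).1 y = (seq N₀).1 y :=
      hN₀ _ (le_trans hN' (le_max_right _ _)) y hy
    have h3 : (seq N').1 y = (seq N₀).1 y := hN₀ _ hN' y hy
    simp only [hg]
    rw [← h1, h2, h3]
  -- smoothness
  have hgs : ContMDiff I 𝓘(ℝ, ℝ) ∞ g := by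
    intro x
    obtain ⟨N₀, hN₀⟩ := hloc x
    exact ((seq N₀).2.1 x).congr_of_eventuallyEq (hN₀ N₀ le_rfl)
  -- distance to `f₀`
  have hdist : ∀ (k : ℕ) (x : M), |(seq k).1 x - f₀ x| ≤ 1 - (2 : ℝ)⁻¹ ^ k := by
    intro k x
    induction k with
    | zero => simp [seq, s₀]
    | succ k ih =>
      have h1 := (hQ k).1 x
      calc |(seq (k + 1)).1 x - f₀ x|
          ≤ |(seq (k + 1)).1 x - (seq k).1 x| + |(seq k).1 x - f₀ x| := abs_sub_le _ _ _
        _ ≤ (2 : ℝ)⁻¹ ^ (k + 1) + (1 - (2 : ℝ)⁻¹ ^ k) := add_le_add h1 ih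
        _ = 1 - (2 : ℝ)⁻¹ ^ (k + 1) := by rw [pow_succ]; ring
  have hg_ge : ∀ x, f₀ x - 1 ≤ g x := by
    intro x
    have h1 := hdist (N x) x
    have h2 : (0 : ℝ) ≤ (2 : ℝ)⁻¹ ^ N x := pow_nonneg (by norm_num) _
    have h3 : |g x - f₀ x| ≤ 1 := by simp only [hg]; linarith
    linarith [neg_abs_le (g x - f₀ x)]
  refine ⟨g, ⟨hgs, fun x hx => ?_⟩, fun x => by linarith [hg_ge x, hf₀1 x],
    tendsto_atTop_mono hg_ge (tendsto_atTop_add_const_right _ (-1) hf₀t)⟩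
  -- no degenerate critical points: read `g = seq N'` in a ball of the cover containing `x`
  obtain ⟨b, hbS, hxU⟩ := hSU x
  obtain ⟨N₀, hN₀⟩ := hloc x
  set N' : ℕ := max N₀ (code ⟨b, hbS⟩ + 1) with hN'
  have hev : g =ᶠ[𝓝 x] (seq N').1 := hN₀ N' (le_max_left _ _)
  have hev0 : g =ᶠ[𝓝 x] fun y => (seq N').1 y + 0 := by simp only [add_zero]; exact hev
  have hf : ContMDiff I 𝓘(ℝ, ℝ) ∞ (seq N').1 := (seq N').2.1
  have hgood : b.Good (seq N').1 :=
    (seq N').2.2 ⟨b, hbS⟩ (lt_of_lt_of_le (Nat.lt_succ_self _) (le_max_right _ _))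
  have hxsrc : x ∈ (interiorExtChart I b.c).source :=
    b.mem_source_of_dist_le hxU.1 (le_of_lt (lt_of_lt_of_le (mem_ball.1 hxU.2)
      (by linarith [b.r_pos])))
  have hcrit : IsMCriticalPt I (seq N').1 x :=
    (isMCriticalPt_congr_of_eventuallyEq_add_const hev0).1 hx
  have hd0 : fderiv ℝ (b.fhat (seq N').1) (extChartAt I b.c x) = 0 :=
    (b.isMCriticalPt_iff hf hxsrc).1 hcrit
  have hinj : Injective (fderiv ℝ (fderiv ℝ (b.fhat (seq N').1)) (extChartAt I b.c x)) :=
    hgood _ (b.ext_mem_K_of_mem_U hxU) hd0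
  rw [mhessian_congr_of_eventuallyEq_add_const hev0]
  exact (nondegenerate_mhessian_iff_of_isMCriticalPt (contMDiffOn_interiorExtChart I b.c)
    (contMDiffOn_interiorExtChart_symm I b.c) hf hxsrc (hint x) hcrit).2 hinj


/-- **Non-negative proper Morse functions on manifolds modelled on `ℝⁿ`** (Phillips 1967,
Lemma 1.1, first clause, in the conventions of the SPC4 files: `M` Hausdorff, second countable,
charted on `EuclideanSpace ℝ (Fin n)` with the boundaryless model `𝓡 n`): the instance
bookkeeping (local compactness and σ-compactness from second countability, `volume` as the Haar
measure on the model) for `exists_isMorse_tendsto_cocompact_atTop`.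
[cite: Phillips1967, Lemma 1.1 (p. 176)] -/
theorem exists_isMorse_tendsto_cocompact_atTop_euclidean (n : ℕ) (M : Type u)
    [TopologicalSpace M] [T2Space M] [SecondCountableTopology M]
    [ChartedSpace (EuclideanSpace ℝ (Fin n)) M] [IsManifold (𝓡 n) ∞ M] :
    ∃ g : M → ℝ, IsMorse (𝓡 n) g ∧ (∀ x, 0 ≤ g x) ∧ Tendsto g (cocompact M) atTop := by
  haveI : LocallyCompactSpace M := ChartedSpace.locallyCompactSpace (EuclideanSpace ℝ (Fin n)) M
  haveI : SigmaCompactSpace M := sigmaCompactSpace_of_locallyCompact_secondCountable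
  exact exists_isMorse_tendsto_cocompact_atTop


/-! ### Regular levels of a proper Morse function are cofinal -/

omit [T2Space M] in
/-- **The critical points of a Morse function in a compact set are finite** (Milnor, *Morse
theory* (1963), Cor. 2.3: nondegenerate critical points are isolated — the tree's
`eventually_not_isMCriticalPt_of_nondegenerate` — and the critical set is closed). General model
with corners; the Euclidean-model case is `IsMorse.finite_criticalSet_inter_of_isCompact`
(`MorseHomologyVanishing.lean`). [cite: Milnor1963, Cor. 2.3] -/
theorem finite_criticalSet_inter_of_isCompact_of_isMorse {f : M → ℝ} (hf : IsMorse I f)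
    {K : Set M} (hK : IsCompact K) : (criticalSet I f ∩ K).Finite := by
  have h2 : (2 : WithTop ℕ∞) ≤ ∞ := by norm_cast
  have hcl : IsClosed (criticalSet I f) := isClosed_criticalSet_of_contMDiff hf.1 h2
  have hcpt : IsCompact (criticalSet I f ∩ K) := hK.inter_left hcl
  obtain ⟨t, -, hcover⟩ := hcpt.elim_nhds_subcover
    (fun p => {x | x = p ∨ ¬ IsMCriticalPt I f x}) fun p hp => by
      have := eventually_not_isMCriticalPt_of_nondegenerate hf.1 h2 hp.1 (hf.2 p hp.1)
      rw [eventually_nhdsWithin_iff] at this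
      filter_upwards [this] with x hx
      by_cases hxp : x = p
      · exact Or.inl hxp
      · exact Or.inr (hx hxp)
  refine t.finite_toSet.subset fun x hx => ?_
  obtain ⟨p, hpt, hxp⟩ := mem_iUnion₂.1 (hcover hx)
  rcases hxp with rfl | h
  · exact hpt
  · exact absurd hx.1 h

omit [T2Space M] in
/-- **Regular values of a proper Morse function are cofinal**: above every `a` there is a level
`c ∈ (a, a + 1)` through no critical point — the sublevel set `{f ≤ a + 1}` is compact, so it
contains finitely many critical points, whose values are avoided. (Phillips 1967, proof of
Lemma 1.1: "realize `M` as an expanding union of compact manifolds with smooth boundary";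
Milnor, *Morse theory* (1963), §6.) [cite: Phillips1967, Lemma 1.1 (p. 176)] -/
theorem exists_regularLevel_gt_of_isMorse {f : M → ℝ} (hf : IsMorse I f)
    (hprop : Tendsto f (cocompact M) atTop) (a : ℝ) :
    ∃ c, a < c ∧ c < a + 1 ∧ ∀ x, f x = c → ¬ IsMCriticalPt I f x := by
  -- the sublevel set `{f ≤ a + 1}` is compact
  have hK : IsCompact (f ⁻¹' Iic (a + 1)) := by
    rw [(hasBasis_cocompact (X := M)).tendsto_iff atTop_basis] at hprop
    obtain ⟨K, hK, hKf⟩ := hprop (a + 2) trivial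
    refine hK.of_isClosed_subset (isClosed_Iic.preimage hf.1.continuous) fun x hx => ?_
    by_contra hxK
    have h1 : a + 2 ≤ f x := hKf x hxK
    have h2 : f x ≤ a + 1 := hx
    linarith
  -- finitely many critical values below `a + 1`
  have hfin : (f '' (criticalSet I f ∩ f ⁻¹' Iic (a + 1))).Finite :=
    (finite_criticalSet_inter_of_isCompact_of_isMorse hf hK).image f
  obtain ⟨c, ⟨hac, hca⟩, hcV⟩ := ((Ioo_infinite (show a < a + 1 by linarith)).sdiff hfin).nonempty
  refine ⟨c, hac, hca, fun x hx hcrit => hcV ⟨x, ⟨hcrit, ?_⟩, hx⟩⟩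
  show f x ≤ a + 1
  rw [hx]
  exact hca.le

omit [T2Space M] in
/-- **Exhaustion by regular sublevel sets** (Phillips 1967, proof of Lemma 1.1, first step:
"First realize `M` as `⋃ Mᵢ`, an expanding union of compact manifolds with smooth boundary,
such that `Mᵢ ⊂ Int Mᵢ₊₁`"): for a proper Morse function `f` there is a strictly increasing
sequence of regular levels `c k → +∞`; the sets `{f ≤ c k}` are then compact, exhaust `M`, and
`{f ≤ c k} ⊆ {f < c (k+1)}`. [cite: Phillips1967, Lemma 1.1 (p. 176)] -/
theorem exists_strictMono_regularLevel_of_isMorse {f : M → ℝ} (hf : IsMorse I f)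
    (hprop : Tendsto f (cocompact M) atTop) :
    ∃ c : ℕ → ℝ, StrictMono c ∧ Tendsto c atTop atTop ∧
      ∀ k x, f x = c k → ¬ IsMCriticalPt I f x := by
  choose r hr using fun a => exists_regularLevel_gt_of_isMorse hf hprop a
  let c : ℕ → ℝ := fun k => Nat.rec (r 0) (fun k ck => r (max ck (k + 1))) k
  have hc_succ : ∀ k, c (k + 1) = r (max (c k) (k + 1)) := fun k => rfl
  have hlt : ∀ k : ℕ, (k : ℝ) < c k := by
    intro k
    cases k with
    | zero => exact_mod_cast (hr 0).1
    | succ k =>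
      rw [hc_succ]
      have := (hr (max (c k) (k + 1))).1
      push_cast
      exact lt_of_le_of_lt (le_max_right _ _) this
  refine ⟨c, strictMono_nat_of_lt_succ fun k => ?_, ?_, fun k x hx => ?_⟩
  · rw [hc_succ]
    exact lt_of_le_of_lt (le_max_left _ _) (hr _).1
  · exact tendsto_atTop_mono (fun k => (hlt k).le) tendsto_natCast_atTop_atTop
  · cases k with
    | zero => exact (hr 0).2.2 x hx
    | succ k => exact (hr (max (c k) (k + 1))).2.2 x (by rw [hx, hc_succ])

end Literature.Topology.FourManifolds
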